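import Mathlib
import Summits.ValiantsHypothesis.ValiantsHypothesis.Theorems.LacunarySymmetroidMatrixDescartesCensusDefs
import Summits.ValiantsHypothesis.ValiantsHypothesis.Theorems.KPlusLogSqLawWeakLiftingTowerGraftExponentHalvingGram

/-!
# Tower graft line — THE EXACT SCOPE OF THE EXCHANGE: every level in the AFFINE-DYADIC HULL of the support is absorbed

Sequel to `…TowerGraftExponentHalvingGram.lean` (same seat; LINE (B) `Cruxes/WeakLifting/Lines/tower_graft.lean`, crux `WeakLifting` =
stmt-ValiantsHypothesis-19561; g21 README NEXT (o)(ii) «a `reachable` predicate closed under `D ↦ 2D − e` would state the exact scope»).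
NO stub is claimed; calibration tier.

The one-step law `posRootLawOn_snoc_halve_two` (`ζ₊(m; d, 2b − e) ≤ ζ₊(2m; d, b)` for every level `e = d l` of the support) iterates along ANY
chain of levels `D₀ ∈ d`, `D_{i+1} = 2·D_i − d(l_i)` (`d(l_i) ≤ 2·D_i`): the far letter at the end `D_n` of a chain of length `n` is absorbed by
the `K`-letter class at size `2ⁿ·m` (`posRootLawOn_snoc_of_chain`).  Stated def-free with the chain as data (`D : Fin (n+1) → ℕ`,
`l : Fin n → Fin K`).  The prequels' scopes are the chains inside this one: multiples `j·d l₁` on supports through `0` (binary expansion of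
`j`), every `D` on supports through `0, 1`.  Example outside them: on `d = (0, 4, 6)` the level `2` is reached in one step (`2 = 2·4 − 6`), so
`ζ₊(m; (0,4,6), 2) ≤ ζ₊(2m; (0,4,6))`, although `2` is no multiple of a level.

HONEST FRAMING: bookkeeping over the prequel; nothing on S4/S4b/S4d/S4f/S5/S5ᴸ, TowerB, `WeakLifting`, Conjecture B, 18050 or VP ≠ VNP;
zero crux credit.  Def-free.  Seat: prover val-sym-lift-p2 g22, `--supports stmt-ValiantsHypothesis-19561 --as helper`.
-/

-- `Summit.ValiantsHypothesis.ValiantsHypothesis.…` repeats a component by the D-0017 layout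
-- (single-conjunct summit), which the `dupNamespace` linter flags; the name is mandated.
set_option linter.dupNamespace false

namespace Summit.ValiantsHypothesis.ValiantsHypothesis.Theorems.KPlusLogSqLaw.TowerGraft

open Finset Polynomial Matrix
open scoped BigOperators Polynomial
open Summit.ValiantsHypothesis.ValiantsHypothesis.Theorems.LacunarySymmetroidMatrixDescartes (PosRootLawOn)

variable {K B : ℕ}

/-- **ABSORPTION ALONG A HALVING CHAIN.**  Let `D : Fin (n+1) → ℕ` be a chain of levels starting AT a level of the support (`D 0 = d l₀`) with
`D (i+1) = 2·D i − d (l i)` and `d (l i) ≤ 2·D i` at every step.  Then `PosRootLawOn (2ⁿ·m) K B d → PosRootLawOn m (K+1) B (d, D n)`: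
the far letter at the end of the chain is absorbed by the `K`-letter class at size `2ⁿ·m`. [this work] -/
theorem posRootLawOn_snoc_of_chain (d : Fin K → ℕ) :
    ∀ (n : ℕ) {m : ℕ} (D : Fin (n + 1) → ℕ) (l : Fin n → Fin K) (l₀ : Fin K), D 0 = d l₀ →
      (∀ i : Fin n, d (l i) ≤ 2 * D i.castSucc ∧ D i.succ = 2 * D i.castSucc - d (l i)) →
      PosRootLawOn (2 ^ n * m) K B d → PosRootLawOn m (K + 1) B (Fin.snoc d (D (Fin.last n))) := by
  intro n
  induction n with
  | zero =>
    intro m D l l₀ h0 _ h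
    rw [pow_zero, one_mul] at h
    have : D (Fin.last 0) = d l₀ := by rw [show (Fin.last 0 : Fin 1) = 0 from rfl, h0]
    rw [this]
    exact posRootLawOn_snoc_self d l₀ h
  | succ n ih =>
    intro m D l l₀ h0 hstep h
    -- the truncated chain of length `n` at size `m + m`
    have h2 : PosRootLawOn (2 ^ n * (m + m)) K B d := by
      have e2 : 2 ^ (n + 1) * m = 2 ^ n * (m + m) := by ring
      rw [e2] at h
      exact h
    have hD' : PosRootLawOn (m + m) (K + 1) B (Fin.snoc d (D (Fin.last n).castSucc)) := by
      have := ih (m := m + m) (fun i => D i.castSucc) (fun i => l i.castSucc) l₀ (by simpa using h0)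
        (fun i => by simpa using hstep i.castSucc) h2
      simpa using this
    obtain ⟨hle, heq⟩ := hstep (Fin.last n)
    rw [show (Fin.last n).succ = Fin.last (n + 1) from rfl] at heq
    rw [heq]
    exact posRootLawOn_snoc_halve_two d (l (Fin.last n)) (D (Fin.last n).castSucc) hle hD'

/-- **example outside the dyadic scopes**: on any support containing the levels `4` and `6` (letters `l₄`, `l₆`), the level `2 = 2·4 − 6` is
absorbed in ONE halving: `ζ₊(m; d, 2) ≤ ζ₊(2m; d)`. [this work] -/
theorem posRootLawOn_snoc_two_of_four_six (d : Fin K → ℕ) (l₄ l₆ : Fin K) (h4 : d l₄ = 4) (h6 : d l₆ = 6) {m : ℕ}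
    (h : PosRootLawOn (m + m) K B d) : PosRootLawOn m (K + 1) B (Fin.snoc d 2) := by
  have step := posRootLawOn_snoc_halve_two d l₆ (d l₄) (by rw [h4, h6]; norm_num) (posRootLawOn_snoc_self d l₄ h)
  rwa [h4, h6] at step

end Summit.ValiantsHypothesis.ValiantsHypothesis.Theorems.KPlusLogSqLaw.TowerGraft
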